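import Summits.QuantumFields.BalabanUV.T4Continuum.Spine.NE7c.LiveFactorGlobalCompact
import Summits.QuantumFields.BalabanUV.T4Continuum.Support.B16HistoryTowerExtractionDataLWR

/-!
# `T4Continuum.Spine.NE7c.LiveFactorTowerShell` — spine estimate NE7c (node U5b), road (δ), member (δ-global-compact)
# AT THE TOWER: junction J-δ∕IR1031 in kernel form — for a threshold-parametric tower family with assignment-free
# `branch`, `LiveFactorGlobalCompact.shellWeightBound_of_globalCompact` INHABITS the four NE7c fields ⟨shA, shB, Wsh, shell⟩
# of IR-103-1's record `B16HistoryTowerExtractionDataLWR.TowerExtractionDataLWR` at the chosen tower `T c⋆`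
# (cell `pub-balaban-gaps`, track G2, seat ne8 gen 9; record `HOME/ne/NE7c.md` §16)

HONEST FRAMING.  Finite four-torus programme, rung (B)+1 only — NOT infinite volume, NOT a mass gap, NOT the Clay
problem, NOT summit progress, NOT a proof of NE7c (`T4IndicatorShell.ShellWeightBound`, INSTANCE 0∕1, which waits on
node O ∕ the (A1c) instance).  Nothing of [Bałaban 1983–89] is asserted: threshold randomisation (road (δ)) is the cell's
device; everything below is bookkeeping over an ABSTRACT tower family and abstract nonnegative weights.  Every input is an
explicit hypothesis; no `def`; 0 sorry.  Spine PROVED 0∕9 — unchanged by this file.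

WHAT.  IR-103-1 (`Support/B16HistoryTowerExtractionDataLWR`, p354906; road `Support/B16HistoryTowerExtractionEnd`) binds
NE7c as the four fields `shA shB Wsh shell` of ONE record over ONE tower family `T : (K : ℕ) → Tower P (X K) (𝒢 K)`:
`shell : ShellWeightBound l₀ (HIndex.termSet (skelFam T p₀)) (fun _ t => Repr172R.weight μ (reprFam T p₀ ρ₀ hρ₀ h0 1 _) t)
(weightB μ (reprFam T p₀ ρ₀ hρ₀ h0 1 _) trunc) shA shB Wsh` (:326–328), read BY NAME by the road's
`hybridNE7_of_towerExtraction`.  Road (δ)'s member (δ-global-compact) (`LiveFactorGlobalCompact`, p354120) produces ONE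
threshold assignment `c⋆ : ℕ → ℕ` for all cutoffs and `ShellWeightBound` BY NAME for the two runs written with `c⋆` —
over ONE index type and ONE term-set family.  At the tower the assignment enters the STEP MAPS `op` (the characteristic
functions of the 𝐑-operations carry the thresholds) and NOT the admissible choices `branch` (index convention C-ρ-TOWER,
ruling W-ne7bp1-g103-2 (1): `branch` ranges over print's live outcomes — regions, renewals, mergers —, a set of LABELS).
(§1) `Tower.adm`, the skeleton `skel` and hence the term sets `HIndex.termSet (skelFam T p₀)` read `branch` ONLY: two tower
families with the same `branch` have the SAME term sets (`termSet_eq_of_branch_eq`; the index TYPE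
`HIndex.Idx (skelFam T p₀) = Σ K, Σ _ : Bool, (Fin K → P) × Unit × Unit` is tower-free by `rfl`); so does the step
reading's `HistReading` (`reading_heq`), hence EVERY COMBINATORIAL CARRIER read off (skeleton family, reading) — M2-B's
input family, keys, key fibres, bad classes, the budget's saturated bad set — is assignment-free
(`carrier_heq_of_branch_eq` ∕ `carrier_eq_of_branch_eq`): only the WEIGHTS and print's per-step displays move with the
assignment.  (§2) THE JUNCTION
`towerShell_of_globalCompact`: for a threshold-parametric family `c ↦ T c` with assignment-free `branch`, dressed initial
densities `ρ₀ c`, truncations `trunc c`, and — per grid assignment `c` — the two runs' realized slot ledgers over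
`HIndex.termSet (skelFam (T c) p₀)` with M2-A's weights `Repr172R.weight μ (reprFam (T c) p₀ …)` (run A) and node O's aggregates
`weightB μ (reprFam (T c) p₀ …) (trunc c)` (run B), floors, finite dependence (FD), own-level candidate sums (L2↓), covers,
loss factors and the window majorant — VERBATIM the hypotheses of `shellWeightBound_of_globalCompact` at these carriers —,
there is ONE grid assignment `c⋆` and a budget `Wsh` with `ShellWeightBound l₀ (HIndex.termSet (skelFam (T c⋆) p₀))
(fun _ t => Repr172R.weight μ (reprFam (T c⋆) p₀ …) t) (weightB μ (reprFam (T c⋆) p₀ …) (trunc c⋆)) (shA c⋆) (shB c⋆) Wsh` — LETTER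
FOR LETTER the record's `shell` field at the tower `T c⋆` with `shA := shA c⋆`, `shB := shB c⋆`.  Proof: transport every
per-assignment hypothesis to the reference carrier `HIndex.termSet (skelFam (T 0) p₀)` by §1, apply
`shellWeightBound_of_globalCompact`, transport back.  CONSEQUENCE (interface word J-δ∕IR1031 of gen 8, now kernel): an
(A1c-0) builder that is threshold-parametric — `c ↦ (op c, ρ₀ c, trunc c, ledgers c)` over a FIXED `branch` — fills the
record's NE7c fields by ONE `exact` at the chosen `c⋆`, building every other field of the record at `T c⋆`; the order of
quantifiers is «build `c ↦ T c` and the level data → pick `c⋆` → instantiate the record at `T c⋆`».  (§3) That order of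
quantifiers AGAINST THE RECORD: a builder returning `TowerExtractionDataLWR … P X 𝒢 μ` from the `shell` display at `T c` for
EVERY grid assignment `c` (`build`), with §2, inhabits the record — the component `Nonempty (TowerExtractionDataLWR …)` of
the road's `hRead` in `B16HistoryTowerExtractionEnd.continuumYM4Torus_of_towerExtraction_fsc`
(`nonempty_towerExtraction_of_parametric`; one call `nonempty_towerExtraction_of_globalCompact`).

INPUTS LEFT (located, NOT discharged — as `LiveFactorGlobalCompact`): the realized ledgers for every grid assignment (input
(L1-levelwise), census `HOME/ne/NE7c.md` §14; cross-level part kernel in `LiveFactorCrossLevel`); (L2↓)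
(`LiveFactorGlobalCascade`); (FD); floors; the window majorant; node O.  NE7c NOT proved.
-/


namespace Summit.QuantumFields.BalabanUV.T4Continuum.Spine.NE7c.LiveFactorTowerShell

open Finset MeasureTheory
open Literature.MathematicalPhysics.QuantumFieldTheory.Balaban1983to89
open Literature.MathematicalPhysics.QuantumFieldTheory.Balaban1983to89.T4ShellMeasure
open Summit.QuantumFields.BalabanUV.T4Continuum.B16HistoryIndexedRepr
open Summit.QuantumFields.BalabanUV.T4Continuum.B16HistoryIndexedTrunc
open Summit.QuantumFields.BalabanUV.T4Continuum.B16HistoryReprChain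
open Summit.QuantumFields.BalabanUV.T4Continuum.B16HistoryReprInstance
open Summit.QuantumFields.BalabanUV.T4Continuum.Spine.NE7c.LiveFactorGlobalCompact

universe u

/-! ## §1 The carriers of the tower's term family read `branch` only -/

section Carrier

variable {P : Type} {C : ℕ → Type u} {𝒢 : (j : ℕ) → GoodClass (C j)}

/-- **THE ADMISSIBLE HISTORIES READ `branch` ONLY**: two towers with the same admissible next choices have the same
admissible histories at every length (the step maps `op` never enter `Tower.adm`). [folklore] -/
theorem adm_eq_of_branch_eq {T T' : Tower P C 𝒢} (h : T.branch = T'.branch) : ∀ K, T.adm K = T'.adm K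
  | 0 => rfl
  | K + 1 => by
      ext g
      rw [Tower.mem_adm_succ, Tower.mem_adm_succ, adm_eq_of_branch_eq h K, h]

end Carrier

section Skeleton

variable {P : Type} [DecidableEq P] {C : ℕ → Type} {𝒢 : (j : ℕ) → GoodClass (C j)}

/-- **THE INDEX SKELETON READS `adm K` ONLY**: `skel T p₀ K` (M1's `HIndex` of the tower at cutoff `K`) depends on the
tower through the finite set `T.adm K` of admissible histories alone (its `HZs` coordinate). [folklore] -/
theorem skel_eq_of_adm_eq {T T' : Tower P C 𝒢} (p₀ : ℕ → P) {K : ℕ} (h : T.adm K = T'.adm K) :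
    skel T p₀ K = skel T' p₀ K := by
  unfold skel
  rw [h]

end Skeleton

section Family

variable {P : Type} [DecidableEq P] {X : ℕ → ℕ → Type} {𝒢 : (K j : ℕ) → GoodClass (X K j)}

/-- **THE CUTOFF FAMILY OF SKELETONS READS `branch` ONLY**: tower families with the same admissible next choices have
the same skeleton family `skelFam`. [folklore] -/
theorem skelFam_eq_of_branch_eq {T T' : (K : ℕ) → Tower P (X K) (𝒢 K)} (p₀ : ℕ → ℕ → P)
    (h : ∀ K, (T K).branch = (T' K).branch) : skelFam T p₀ = skelFam T' p₀ :=
  funext fun K => skel_eq_of_adm_eq (p₀ K) (adm_eq_of_branch_eq (h K) K)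

/-- equal skeleton families have (heterogeneously) equal term-set families. [folklore] -/
theorem termSet_heq {DomK : ℕ → Type*} {I I' : (K : ℕ) → HIndex (DomK K)} (e : I = I') :
    HEq (HIndex.termSet I) (HIndex.termSet I') := by
  subst e
  exact HEq.rfl

/-- **THE TERM SETS OF THE TOWER's SKELETON READ `branch` ONLY** (index convention C-ρ-TOWER: the thresholds of a
threshold-parametric tower family sit in the step maps `op`, not in the labels `branch`): tower families with the same
`branch` have the SAME term sets `HIndex.termSet (skelFam T p₀)` — an equation in the common, tower-free index type
`HIndex.Idx (skelFam · p₀) = Σ K, Σ _ : Bool, (Fin K → P) × Unit × Unit`. [folklore] -/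
theorem termSet_eq_of_branch_eq {T T' : (K : ℕ) → Tower P (X K) (𝒢 K)} (p₀ : ℕ → ℕ → P)
    (h : ∀ K, (T K).branch = (T' K).branch) :
    HIndex.termSet (skelFam T p₀) = (HIndex.termSet (skelFam T' p₀) : _) :=
  eq_of_heq (termSet_heq (skelFam_eq_of_branch_eq p₀ h))

/-- the index type of the tower's term family is tower-free, by `rfl`. [folklore] -/
theorem idx_skelFam_eq (T : (K : ℕ) → Tower P (X K) (𝒢 K)) (p₀ : ℕ → ℕ → P) :
    HIndex.Idx (skelFam T p₀) = (Σ K : ℕ, Σ _ : Bool, (Fin K → P) × Unit × Unit) := rfl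

/-- **THE STEP READING's `HistReading` READS `branch` ONLY** (`B16HistoryReprReadCausal.StepReading.reading`: the regions,
classes and new-field cubes are read off the HISTORY `ι.1 : Fin K → P`; the tower enters through the skeleton's type
alone): tower families with the same `branch` induce heterogeneously equal readings. [folklore] -/
theorem reading_heq {d : ℕ} (𝒮 : B16HistoryReprReadCausal.StepReading P d) (p₀ : ℕ → ℕ → P)
    {T T' : (K : ℕ) → Tower P (X K) (𝒢 K)} (h : ∀ K, (T K).branch = (T' K).branch) :
    HEq (𝒮.reading T p₀) (𝒮.reading T' p₀) := by
  have key : ∀ (I I' : ℕ → HIndex Unit), I = I' →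
      ∀ (dec : (K : ℕ) → (I K).Adm → (I K).HZ × (I K).HL × (I K).HC → (Fin K → P))
        (dec' : (K : ℕ) → (I' K).Adm → (I' K).HZ × (I' K).HL × (I' K).HC → (Fin K → P)), HEq dec dec' →
        HEq (HistReading.mk (I := I) (d := d) 𝒮.L 𝒮.s 𝒮.R 𝒮.Rm (fun K a ι => 𝒮.Nof K K (dec K a ι))
              (fun K _ _ => 𝒮.κ K) (fun K a ι => 𝒮.Fof K K (dec K a ι)))
          (HistReading.mk (I := I') (d := d) 𝒮.L 𝒮.s 𝒮.R 𝒮.Rm (fun K a ι => 𝒮.Nof K K (dec' K a ι))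
              (fun K _ _ => 𝒮.κ K) (fun K a ι => 𝒮.Fof K K (dec' K a ι))) := by
    intro I I' hI
    subst hI
    intro dec dec' hdec
    cases hdec
    exact HEq.rfl
  unfold B16HistoryReprReadCausal.StepReading.reading
  exact key _ _ (skelFam_eq_of_branch_eq p₀ h) (fun K _ ι => ι.1) (fun K _ ι => ι.1) HEq.rfl

/-- **EVERY COMBINATORIAL CARRIER READ OFF (skeleton family, step reading) IS ASSIGNMENT-FREE** — heterogeneous form:
for any construction `Φ I ℛ` from a skeleton family and a `HistReading` over it (term sets, M2-B's input family, keys,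
key fibres, bad classes, the budget's saturated bad set …), tower families with the same `branch` give heterogeneously
equal values. [folklore] -/
theorem carrier_heq_of_branch_eq {d : ℕ} (𝒮 : B16HistoryReprReadCausal.StepReading P d) (p₀ : ℕ → ℕ → P)
    {T T' : (K : ℕ) → Tower P (X K) (𝒢 K)} (h : ∀ K, (T K).branch = (T' K).branch)
    {β : ((K : ℕ) → HIndex Unit) → Sort*}
    (Φ : (I : (K : ℕ) → HIndex Unit) → HistReading I d → β I) :
    HEq (Φ (skelFam T p₀) (𝒮.reading T p₀)) (Φ (skelFam T' p₀) (𝒮.reading T' p₀)) := by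
  have key : ∀ (I I' : (K : ℕ) → HIndex Unit), I = I' → ∀ (r : HistReading I d)
      (r' : HistReading I' d), HEq r r' → HEq (Φ I r) (Φ I' r') := by
    intro I I' hI
    subst hI
    intro r r' hr
    cases hr
    exact HEq.rfl
  exact key _ _ (skelFam_eq_of_branch_eq p₀ h) _ _ (reading_heq 𝒮 p₀ h)

/-- … and the homogeneous form for carriers valued in an assignment-free type (keys, counts, finsets of keys): EQUAL.
[folklore] -/
theorem carrier_eq_of_branch_eq {d : ℕ} (𝒮 : B16HistoryReprReadCausal.StepReading P d) (p₀ : ℕ → ℕ → P)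
    {T T' : (K : ℕ) → Tower P (X K) (𝒢 K)} (h : ∀ K, (T K).branch = (T' K).branch) {β : Sort*}
    (Φ : (I : (K : ℕ) → HIndex Unit) → HistReading I d → β) :
    Φ (skelFam T p₀) (𝒮.reading T p₀) = Φ (skelFam T' p₀) (𝒮.reading T' p₀) :=
  eq_of_heq (carrier_heq_of_branch_eq 𝒮 p₀ h (β := fun _ => β) Φ)

end Family

/-! ## §2 The junction: member (δ-global-compact) inhabits the record's NE7c fields at the chosen tower -/

section Junction

variable {P : Type} [DecidableEq P] {X : ℕ → ℕ → Type} {𝒢 : (K j : ℕ) → GoodClass (X K j)}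
  [∀ K, MeasurableSpace (X K K)]

/-- **JUNCTION J-δ∕IR1031 — THE RECORD's `shell` FIELD AT THE TOWER `T c⋆` FROM MEMBER (δ-global-compact).**
DATA: reference measures `μ`; a THRESHOLD-PARAMETRIC tower family `T c` (`c : ℕ → ℕ` the global threshold assignment)
with ASSIGNMENT-FREE `branch` (`hbr`, C-ρ-TOWER); small-field choices `p₀`; dressed initial densities `ρ₀ c` (good,
nonnegative); node O's truncations `trunc c`; candidate counts `n`, books `B`, windows `W`; per assignment the two runs'
shell parts `shA c ∕ shB c`, slots `SA ∕ SB`, pieces `pieceA c ∕ pieceB c`.  HYPOTHESES — those of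
`LiveFactorGlobalCompact.shellWeightBound_of_globalCompact` AT THE TOWER's CARRIERS, per grid assignment `c`: realized slot
ledgers `hLA ∕ hLB` over `HIndex.termSet (skelFam (T c) p₀)` for M2-A's weights `Repr172R.weight μ (reprFam (T c) p₀ (ρ₀ c) …)`
(run A) and the aggregates `weightB μ (reprFam (T c) p₀ (ρ₀ c) …) (trunc c)` (run B = the family at cutoff `K + 1` through
`trunc`, (Δ2)); floors `ZA ∕ ZB` below the two runs' totals at `t = 0` (`hZAle ∕ hZBle`); level weights `wA ∕ wB ≥ 0` with
finite dependence (FD) `hdepA ∕ hdepB` and own-level candidate sums (L2↓) `hA ∕ hB`; covers `hcovA ∕ hcovB`; loss factors `t`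
with `Σ_{j<J} 1∕t j < 1`; rate `0 ≤ ϑ < 1` and the weighted window majorant `hgeo`.  CONCLUSION: ONE grid assignment `c`
and a budget `Wsh` with `T4IndicatorShell.ShellWeightBound l₀ (HIndex.termSet (skelFam (T c) p₀)) (fun _ t => Repr172R.weight μ
(reprFam (T c) p₀ (ρ₀ c) (hρ₀ c) (h0 c) (fun _ _ => 1) (fun _ _ => one_pos)) t) (weightB μ (reprFam (T c) p₀ …) (trunc c))
(shA c) (shB c) Wsh` — the `shell` field of `TowerExtractionDataLWR` at the tower `T c`, letter for letter.  Proof: §1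
moves every hypothesis to the reference carrier `HIndex.termSet (skelFam (T 0) p₀)`; `shellWeightBound_of_globalCompact`;
§1 moves the conclusion back. [folklore] -/
theorem towerShell_of_globalCompact (μ : (K : ℕ) → Measure (X K K))
    (T : (ℕ → ℕ) → (K : ℕ) → Tower P (X K) (𝒢 K)) (hbr : ∀ c c' K, (T c K).branch = (T c' K).branch)
    (p₀ : ℕ → ℕ → P) (ρ₀ : (ℕ → ℕ) → (K : ℕ) → ℝ → X K 0 → ℝ)
    (hρ₀ : ∀ c K t, (𝒢 K 0).Gd (ρ₀ c K t)) (h0 : ∀ c K t x, 0 ≤ ρ₀ c K t x)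
    (trunc : (c : ℕ → ℕ) → ℕ → HIndex.Idx (skelFam (T c) p₀) → HIndex.Idx (skelFam (T c) p₀))
    {l₀ a C ϑ : ℝ} (n : ℕ → ℕ) (hn : ∀ j, 0 < n j) (B W : ℕ → Finset ℕ) (hWB : ∀ K j, j ∈ W K → K ∈ B j)
    {σ σ' : Type*} (shA shB : (c : ℕ → ℕ) → ℕ → ℝ → HIndex.Idx (skelFam (T c) p₀) → ℝ)
    (SA : ℕ → Finset σ) (SB : ℕ → Finset σ')
    (pieceA : (c : ℕ → ℕ) → ℕ → ℝ → σ → HIndex.Idx (skelFam (T c) p₀) → ℝ)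
    (pieceB : (c : ℕ → ℕ) → ℕ → ℝ → σ' → HIndex.Idx (skelFam (T c) p₀) → ℝ)
    (hLA : ∀ c : ℕ → ℕ, (∀ j, c j < n j) →
      SlotLedger l₀ (HIndex.termSet (skelFam (T c) p₀))
        (fun _ t => Repr172R.weight μ (reprFam (T c) p₀ (ρ₀ c) (hρ₀ c) (h0 c) (fun _ _ => 1) (fun _ _ => one_pos)) t)
        (shA c) SA (pieceA c)
        (fun K s => Real.exp (2 * a) *
          ((∑ τ ∈ HIndex.termSet (skelFam (T c) p₀) K, pieceA c K 0 s τ) /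
            ∑ τ ∈ HIndex.termSet (skelFam (T c) p₀) K,
              Repr172R.weight μ (reprFam (T c) p₀ (ρ₀ c) (hρ₀ c) (h0 c) (fun _ _ => 1) (fun _ _ => one_pos)) 0 τ)))
    (hLB : ∀ c : ℕ → ℕ, (∀ j, c j < n j) →
      SlotLedger l₀ (HIndex.termSet (skelFam (T c) p₀))
        (weightB μ (reprFam (T c) p₀ (ρ₀ c) (hρ₀ c) (h0 c) (fun _ _ => 1) (fun _ _ => one_pos)) (trunc c))
        (shB c) SB (pieceB c)
        (fun K s => Real.exp (2 * a) *
          ((∑ τ ∈ HIndex.termSet (skelFam (T c) p₀) K, pieceB c K 0 s τ) /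
            ∑ τ ∈ HIndex.termSet (skelFam (T c) p₀) K,
              weightB μ (reprFam (T c) p₀ (ρ₀ c) (hρ₀ c) (h0 c) (fun _ _ => 1) (fun _ _ => one_pos)) (trunc c) K 0 τ)))
    {ZA ZB : ℕ → ℝ} (hZA : ∀ K, 0 < ZA K) (hZB : ∀ K, 0 < ZB K)
    (hZAle : ∀ c : ℕ → ℕ, (∀ j, c j < n j) → ∀ K,
      ZA K ≤ ∑ τ ∈ HIndex.termSet (skelFam (T c) p₀) K,
        Repr172R.weight μ (reprFam (T c) p₀ (ρ₀ c) (hρ₀ c) (h0 c) (fun _ _ => 1) (fun _ _ => one_pos)) 0 τ)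
    (hZBle : ∀ c : ℕ → ℕ, (∀ j, c j < n j) → ∀ K,
      ZB K ≤ ∑ τ ∈ HIndex.termSet (skelFam (T c) p₀) K,
        weightB μ (reprFam (T c) p₀ (ρ₀ c) (hρ₀ c) (h0 c) (fun _ _ => 1) (fun _ _ => one_pos)) (trunc c) K 0 τ)
    (wA wB : ℕ → ℕ → (ℕ → ℕ) → ℝ) (hA0 : ∀ K j c, 0 ≤ wA K j c) (hB0 : ∀ K j c, 0 ≤ wB K j c)
    (D : ℕ → ℕ → ℕ)
    (hdepA : ∀ K j (c c' : ℕ → ℕ), (∀ l, c l < n l) → (∀ l, c' l < n l) → (∀ l, l < D K j → c l = c' l) →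
      wA K j c = wA K j c')
    (hdepB : ∀ K j (c c' : ℕ → ℕ), (∀ l, c l < n l) → (∀ l, c' l < n l) → (∀ l, l < D K j → c l = c' l) →
      wB K j c = wB K j c')
    (V : ℕ → ℝ) (hV : ∀ j, 0 ≤ V j)
    (hA : ∀ K j (c : ℕ → ℕ), (∀ l, c l < n l) →
      ∑ m ∈ range (n j), wA K j (Function.update c j m) ≤ V j * ZA K)
    (hB : ∀ K j (c : ℕ → ℕ), (∀ l, c l < n l) →
      ∑ m ∈ range (n j), wB K j (Function.update c j m) ≤ V j * ZB K)
    (hcovA : ∀ c : ℕ → ℕ, (∀ j, c j < n j) → ∀ K,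
      ∑ s ∈ SA K, ∑ τ ∈ HIndex.termSet (skelFam (T c) p₀) K, pieceA c K 0 s τ ≤ ∑ j ∈ W K, wA K j c)
    (hcovB : ∀ c : ℕ → ℕ, (∀ j, c j < n j) → ∀ K,
      ∑ s ∈ SB K, ∑ τ ∈ HIndex.termSet (skelFam (T c) p₀) K, pieceB c K 0 s τ ≤ ∑ j ∈ W K, wB K j c)
    (t : ℕ → ℝ) (ht0 : ∀ j, 0 < t j) (ht : ∀ J, ∑ j ∈ range J, (t j)⁻¹ < 1)
    (hϑ0 : 0 ≤ ϑ) (hϑ1 : ϑ < 1)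
    (hgeo : ∀ K, ∑ j ∈ W K, t j * (2 * ((B j).card : ℝ) * V j / n j) ≤ C * ϑ ^ K) :
    ∃ c : ℕ → ℕ, (∀ j, c j < n j) ∧ ∃ Wsh : ℕ → ℝ,
      T4IndicatorShell.ShellWeightBound l₀ (HIndex.termSet (skelFam (T c) p₀))
        (fun _ t => Repr172R.weight μ (reprFam (T c) p₀ (ρ₀ c) (hρ₀ c) (h0 c) (fun _ _ => 1) (fun _ _ => one_pos)) t)
        (weightB μ (reprFam (T c) p₀ (ρ₀ c) (hρ₀ c) (h0 c) (fun _ _ => 1) (fun _ _ => one_pos)) (trunc c))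
        (shA c) (shB c) Wsh := by
  -- §1: every assignment's term sets are those of the reference assignment `0` (assignment-free `branch`)
  have hT : ∀ c : ℕ → ℕ,
      HIndex.termSet (skelFam (T c) p₀) = (HIndex.termSet (skelFam (T (fun _ => 0)) p₀) : _) :=
    fun c => termSet_eq_of_branch_eq p₀ fun K => hbr c (fun _ => 0) K
  obtain ⟨c, hc, h⟩ := shellWeightBound_of_globalCompact
    (T := HIndex.termSet (skelFam (T (fun _ => 0)) p₀)) (l₀ := l₀) (a := a) (C := C) (ϑ := ϑ) n hn B W hWB
    (A := fun c K t τ => Repr172R.weight (I := skelFam (T c) p₀) μ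
      (reprFam (T c) p₀ (ρ₀ c) (hρ₀ c) (h0 c) (fun _ _ => 1) (fun _ _ => one_pos)) t τ)
    (A' := fun c K t τ =>
      weightB μ (reprFam (T c) p₀ (ρ₀ c) (hρ₀ c) (h0 c) (fun _ _ => 1) (fun _ _ => one_pos)) (trunc c) K t τ)
    (shA := fun c K t τ => shA c K t τ) (shA' := fun c K t τ => shB c K t τ) (SA := SA) (SA' := SB)
    (pieceA := fun c K t s τ => pieceA c K t s τ) (pieceA' := fun c K t s τ => pieceB c K t s τ)
    (fun c hc => hT c ▸ hLA c hc) (fun c hc => hT c ▸ hLB c hc) hZA hZB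
    (fun c hc K => hT c ▸ hZAle c hc K) (fun c hc K => hT c ▸ hZBle c hc K)
    wA wB hA0 hB0 D hdepA hdepB V hV hA hB
    (fun c hc K => hT c ▸ hcovA c hc K) (fun c hc K => hT c ▸ hcovB c hc K)
    t ht0 ht hϑ0 hϑ1 hgeo
  exact ⟨c, hc, _, by rw [hT c]; exact h⟩

end Junction

/-! ## §3 Against the record: the ORDER OF QUANTIFIERS of a threshold-parametric (A1c-0) builder -/

section Record

open Literature.MathematicalPhysics.QuantumFieldTheory.Balaban1983to89.T4Continuum
open Summit.QuantumFields.BalabanUV.T4Continuum.HistoryConstants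
open Summit.QuantumFields.BalabanUV.T4Continuum.B16HistoryTowerExtractionDataLWR

variable {F : T4Family} {G : Type*} [GaugeGroup G] [MeasurableSpace G] [HaarData G]
  {D : FiniteEpsData F G} {Cn : T4PrintedShapeBanking.Consts} {O : PrintedO1s} {θv : ℝ} {rr d n : ℕ}
  {hn : 0 < n} {g₀ : ℕ → ℝ} {os : List (ULoop F)} {cΛ M Φ β₀ : ℝ} {p₁ η η' κ κ₂ κᵥ : ℕ}
  {P : Type} [DecidableEq P] {X : ℕ → ℕ → Type} {𝒢 : (K j : ℕ) → GoodClass (X K j)}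
  [∀ K, MeasurableSpace (X K K)] {μ : (K : ℕ) → Measure (X K K)} [∀ K, IsFiniteMeasure (μ K)]

/-- **THE RECORD FROM A THRESHOLD-PARAMETRIC BUILDER AND THE JUNCTION** (the order of quantifiers of interface word
J-δ∕IR1031, kernel; logically one application).  A builder `build` that, for EVERY grid assignment `c` and ANY shell budget
`Wsh` carrying the `shell` display at the tower `T c` with shell parts `shA c ∕ shB c`, returns IR-103-1's record
`TowerExtractionDataLWR … P X 𝒢 μ` (every other field built at `T c`: the budget over the cores `weight − shA c`,
`weightB − shB c`, the extraction displays, the count, print's per-step sentences), together with §2's output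
`∃ c, (∀ j, c j < nC j) ∧ ∃ Wsh, ShellWeightBound …` (`towerShell_of_globalCompact`), inhabits the record — the component
`Nonempty (TowerExtractionDataLWR …)` of the road's `hRead` (`B16HistoryTowerExtractionEnd.continuumYM4Torus_of_towerExtraction_fsc`)
for this tuned run and loop string.  What it pins: the builder must be parametric in the assignment over a FIXED `branch`
(every assignment-dependent displayed row supplied for all grid assignments — road (δ)'s reading (L1-levelwise)), and the
assignment is chosen BEFORE the record is instantiated.  Nothing discharged. [folklore] -/
theorem nonempty_towerExtraction_of_parametric
    (T : (ℕ → ℕ) → (K : ℕ) → Tower P (X K) (𝒢 K)) (p₀ : ℕ → ℕ → P) (ρ₀ : (ℕ → ℕ) → (K : ℕ) → ℝ → X K 0 → ℝ)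
    (hρ₀ : ∀ c K t, (𝒢 K 0).Gd (ρ₀ c K t)) (h0 : ∀ c K t x, 0 ≤ ρ₀ c K t x)
    (trunc : (c : ℕ → ℕ) → ℕ → HIndex.Idx (skelFam (T c) p₀) → HIndex.Idx (skelFam (T c) p₀))
    (nC : ℕ → ℕ) {l₀ : ℝ} (shA shB : (c : ℕ → ℕ) → ℕ → ℝ → HIndex.Idx (skelFam (T c) p₀) → ℝ)
    (build : ∀ c : ℕ → ℕ, (∀ j, c j < nC j) → ∀ Wsh : ℕ → ℝ,
      T4IndicatorShell.ShellWeightBound l₀ (HIndex.termSet (skelFam (T c) p₀))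
        (fun _ t => Repr172R.weight μ (reprFam (T c) p₀ (ρ₀ c) (hρ₀ c) (h0 c) (fun _ _ => 1) (fun _ _ => one_pos)) t)
        (weightB μ (reprFam (T c) p₀ (ρ₀ c) (hρ₀ c) (h0 c) (fun _ _ => 1) (fun _ _ => one_pos)) (trunc c))
        (shA c) (shB c) Wsh →
      TowerExtractionDataLWR D Cn O θv rr d n hn g₀ os cΛ M Φ β₀ p₁ η η' κ κ₂ κᵥ P X 𝒢 μ)
    (hshell : ∃ c : ℕ → ℕ, (∀ j, c j < nC j) ∧ ∃ Wsh : ℕ → ℝ,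
      T4IndicatorShell.ShellWeightBound l₀ (HIndex.termSet (skelFam (T c) p₀))
        (fun _ t => Repr172R.weight μ (reprFam (T c) p₀ (ρ₀ c) (hρ₀ c) (h0 c) (fun _ _ => 1) (fun _ _ => one_pos)) t)
        (weightB μ (reprFam (T c) p₀ (ρ₀ c) (hρ₀ c) (h0 c) (fun _ _ => 1) (fun _ _ => one_pos)) (trunc c))
        (shA c) (shB c) Wsh) :
    Nonempty (TowerExtractionDataLWR D Cn O θv rr d n hn g₀ os cΛ M Φ β₀ p₁ η η' κ κ₂ κᵥ P X 𝒢 μ) := by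
  obtain ⟨c, hc, Wsh, h⟩ := hshell
  exact ⟨build c hc Wsh h⟩

/-- **ONE CALL: MEMBER (δ-global-compact) AT THE TOWER ⇒ THE RECORD**, for a threshold-parametric builder — §2's junction
`towerShell_of_globalCompact` fed to `nonempty_towerExtraction_of_parametric`.  Hypotheses: the builder `build` and, verbatim,
the located inputs of `LiveFactorGlobalCompact.shellWeightBound_of_globalCompact` at the tower's carriers (realized slot
ledgers per grid assignment, floors, (FD), (L2↓), covers, loss factors, window majorant).  Conclusion: the `hRead` component
`Nonempty (TowerExtractionDataLWR …)` of IR-103-1's road for this tuned run and loop string.  Nothing discharged; NE7c NOT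
proved (INSTANCE 0∕1: the builder is node O's). [folklore] -/
theorem nonempty_towerExtraction_of_globalCompact
    (T : (ℕ → ℕ) → (K : ℕ) → Tower P (X K) (𝒢 K)) (hbr : ∀ c c' K, (T c K).branch = (T c' K).branch)
    (p₀ : ℕ → ℕ → P) (ρ₀ : (ℕ → ℕ) → (K : ℕ) → ℝ → X K 0 → ℝ)
    (hρ₀ : ∀ c K t, (𝒢 K 0).Gd (ρ₀ c K t)) (h0 : ∀ c K t x, 0 ≤ ρ₀ c K t x)
    (trunc : (c : ℕ → ℕ) → ℕ → HIndex.Idx (skelFam (T c) p₀) → HIndex.Idx (skelFam (T c) p₀))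
    {l₀ a C ϑ : ℝ} (nC : ℕ → ℕ) (hnC : ∀ j, 0 < nC j) (B W : ℕ → Finset ℕ) (hWB : ∀ K j, j ∈ W K → K ∈ B j)
    {σ σ' : Type*} (shA shB : (c : ℕ → ℕ) → ℕ → ℝ → HIndex.Idx (skelFam (T c) p₀) → ℝ)
    (SA : ℕ → Finset σ) (SB : ℕ → Finset σ')
    (pieceA : (c : ℕ → ℕ) → ℕ → ℝ → σ → HIndex.Idx (skelFam (T c) p₀) → ℝ)
    (pieceB : (c : ℕ → ℕ) → ℕ → ℝ → σ' → HIndex.Idx (skelFam (T c) p₀) → ℝ)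
    (build : ∀ c : ℕ → ℕ, (∀ j, c j < nC j) → ∀ Wsh : ℕ → ℝ,
      T4IndicatorShell.ShellWeightBound l₀ (HIndex.termSet (skelFam (T c) p₀))
        (fun _ t => Repr172R.weight μ (reprFam (T c) p₀ (ρ₀ c) (hρ₀ c) (h0 c) (fun _ _ => 1) (fun _ _ => one_pos)) t)
        (weightB μ (reprFam (T c) p₀ (ρ₀ c) (hρ₀ c) (h0 c) (fun _ _ => 1) (fun _ _ => one_pos)) (trunc c))
        (shA c) (shB c) Wsh →
      TowerExtractionDataLWR D Cn O θv rr d n hn g₀ os cΛ M Φ β₀ p₁ η η' κ κ₂ κᵥ P X 𝒢 μ)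
    (hLA : ∀ c : ℕ → ℕ, (∀ j, c j < nC j) →
      SlotLedger l₀ (HIndex.termSet (skelFam (T c) p₀))
        (fun _ t => Repr172R.weight μ (reprFam (T c) p₀ (ρ₀ c) (hρ₀ c) (h0 c) (fun _ _ => 1) (fun _ _ => one_pos)) t)
        (shA c) SA (pieceA c)
        (fun K s => Real.exp (2 * a) *
          ((∑ τ ∈ HIndex.termSet (skelFam (T c) p₀) K, pieceA c K 0 s τ) /
            ∑ τ ∈ HIndex.termSet (skelFam (T c) p₀) K,
              Repr172R.weight μ (reprFam (T c) p₀ (ρ₀ c) (hρ₀ c) (h0 c) (fun _ _ => 1) (fun _ _ => one_pos)) 0 τ)))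
    (hLB : ∀ c : ℕ → ℕ, (∀ j, c j < nC j) →
      SlotLedger l₀ (HIndex.termSet (skelFam (T c) p₀))
        (weightB μ (reprFam (T c) p₀ (ρ₀ c) (hρ₀ c) (h0 c) (fun _ _ => 1) (fun _ _ => one_pos)) (trunc c))
        (shB c) SB (pieceB c)
        (fun K s => Real.exp (2 * a) *
          ((∑ τ ∈ HIndex.termSet (skelFam (T c) p₀) K, pieceB c K 0 s τ) /
            ∑ τ ∈ HIndex.termSet (skelFam (T c) p₀) K,
              weightB μ (reprFam (T c) p₀ (ρ₀ c) (hρ₀ c) (h0 c) (fun _ _ => 1) (fun _ _ => one_pos)) (trunc c) K 0 τ)))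
    {ZA ZB : ℕ → ℝ} (hZA : ∀ K, 0 < ZA K) (hZB : ∀ K, 0 < ZB K)
    (hZAle : ∀ c : ℕ → ℕ, (∀ j, c j < nC j) → ∀ K,
      ZA K ≤ ∑ τ ∈ HIndex.termSet (skelFam (T c) p₀) K,
        Repr172R.weight μ (reprFam (T c) p₀ (ρ₀ c) (hρ₀ c) (h0 c) (fun _ _ => 1) (fun _ _ => one_pos)) 0 τ)
    (hZBle : ∀ c : ℕ → ℕ, (∀ j, c j < nC j) → ∀ K,
      ZB K ≤ ∑ τ ∈ HIndex.termSet (skelFam (T c) p₀) K,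
        weightB μ (reprFam (T c) p₀ (ρ₀ c) (hρ₀ c) (h0 c) (fun _ _ => 1) (fun _ _ => one_pos)) (trunc c) K 0 τ)
    (wA wB : ℕ → ℕ → (ℕ → ℕ) → ℝ) (hA0 : ∀ K j c, 0 ≤ wA K j c) (hB0 : ∀ K j c, 0 ≤ wB K j c)
    (Dp : ℕ → ℕ → ℕ)
    (hdepA : ∀ K j (c c' : ℕ → ℕ), (∀ l, c l < nC l) → (∀ l, c' l < nC l) → (∀ l, l < Dp K j → c l = c' l) →
      wA K j c = wA K j c')
    (hdepB : ∀ K j (c c' : ℕ → ℕ), (∀ l, c l < nC l) → (∀ l, c' l < nC l) → (∀ l, l < Dp K j → c l = c' l) →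
      wB K j c = wB K j c')
    (V : ℕ → ℝ) (hV : ∀ j, 0 ≤ V j)
    (hA : ∀ K j (c : ℕ → ℕ), (∀ l, c l < nC l) →
      ∑ m ∈ range (nC j), wA K j (Function.update c j m) ≤ V j * ZA K)
    (hB : ∀ K j (c : ℕ → ℕ), (∀ l, c l < nC l) →
      ∑ m ∈ range (nC j), wB K j (Function.update c j m) ≤ V j * ZB K)
    (hcovA : ∀ c : ℕ → ℕ, (∀ j, c j < nC j) → ∀ K,
      ∑ s ∈ SA K, ∑ τ ∈ HIndex.termSet (skelFam (T c) p₀) K, pieceA c K 0 s τ ≤ ∑ j ∈ W K, wA K j c)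
    (hcovB : ∀ c : ℕ → ℕ, (∀ j, c j < nC j) → ∀ K,
      ∑ s ∈ SB K, ∑ τ ∈ HIndex.termSet (skelFam (T c) p₀) K, pieceB c K 0 s τ ≤ ∑ j ∈ W K, wB K j c)
    (t : ℕ → ℝ) (ht0 : ∀ j, 0 < t j) (ht : ∀ J, ∑ j ∈ range J, (t j)⁻¹ < 1)
    (hϑ0 : 0 ≤ ϑ) (hϑ1 : ϑ < 1)
    (hgeo : ∀ K, ∑ j ∈ W K, t j * (2 * ((B j).card : ℝ) * V j / nC j) ≤ C * ϑ ^ K) :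
    Nonempty (TowerExtractionDataLWR D Cn O θv rr d n hn g₀ os cΛ M Φ β₀ p₁ η η' κ κ₂ κᵥ P X 𝒢 μ) :=
  nonempty_towerExtraction_of_parametric T p₀ ρ₀ hρ₀ h0 trunc nC shA shB build
    (towerShell_of_globalCompact μ T hbr p₀ ρ₀ hρ₀ h0 trunc nC hnC B W hWB shA shB SA SB pieceA pieceB hLA hLB
      hZA hZB hZAle hZBle wA wB hA0 hB0 Dp hdepA hdepB V hV hA hB hcovA hcovB t ht0 ht hϑ0 hϑ1 hgeo)

end Record

end Summit.QuantumFields.BalabanUV.T4Continuum.Spine.NE7c.LiveFactorTowerShell
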